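import Mathlib.FieldTheory.Finite.Basic
import Mathlib.Data.ZMod.Units
import Mathlib.Analysis.SpecialFunctions.Pow.Real
import Mathlib.Analysis.SpecialFunctions.Log.Base
import HarnessLib

/-!
# Regev 2023: the exponent lattice of the multidimensional quantum factoring algorithm

O. Regev, *An efficient quantum factoring algorithm*, arXiv:2308.06572 (J. ACM 72 (2025)) [Regev2023]. For an `n`-bit
`N` and small bases `b_1, …, b_d` (invertible mod `N`), the paper defines (p. 3, «Statement of the result») the lattice
`L = {z ∈ ℤ^d : (Π_i b_i^{z_i})² = 1 mod N}` and its sublattice `L₀ = {z ∈ ℤ^d : Π_i b_i^{z_i} ∈ {−1, 1} mod N}`, proves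
the classical post-processing sentence «Given a vector z ∈ L ∖ L₀, … b = Π_i b_i^{z_i} mod N is a square root of unity
modulo N … not equal to ±1 … we therefore must have that gcd(b − 1, N) is a non-trivial factor of N» (p. 3), notes by
pigeon-hole that `L` has nonzero vectors of norm `≤ √d · 2^{n/d}` (p. 4, footnote), and states **Thm 1.1** (p. 4): «Let N
be an n-bit number and assume that for d = √n and O(log n)-bit numbers b_1, …, b_d, there exists a vector in L ∖ L₀ of
norm at most T = exp(O(√n)). Then, there is a classical polynomial-time algorithm that outputs a non-trivial factor of
N using √n + 4 calls to a quantum circuit of size O(n^{3/2} log n).» The hypothesis is printed as «a number-theoretic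
heuristic assumption» (p. 3); C. Pilatte, arXiv:2404.16450, Thm 1.1 [Pilatte2024] later proved unconditionally that a
slightly modified algorithm factors with `O(√n)` calls to a circuit of `O(n^{3/2} log³ n)` gates and `O(n log³ n)`
qubits; S. Ragavan, V. Vaikuntanathan, CRYPTO 2024, Main Thm 1 [RagavanVaikuntanathan2023] reduce the space to
`S + ((C+2)/log φ + 6 + o(1))·n ≈ S + (1.44C + 8.88)·n` qubits with `O(n^{1/2}·G + n^{3/2})` gates per call.

This file (census row QA-A19 of the qa-lwe cell: a RECORD row — here the lattice is the algorithm's TOOL, the target is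
RSA-type factoring, not a lattice scheme) types the printed objects and proves the two elementary printed claims:
* `prodPow`, `lattice`, `sublattice` (as additive subgroups of `ℤ^d`), `sublattice_le_lattice`;
* `regevFactor` = the printed output `gcd(b − 1, N)` and **`regevFactor_nontrivial`**: for `z ∈ L ∖ L₀` it is a proper
  divisor `1 < g < N`, `g ∣ N` (through `nontrivial_factor_of_sq_eq_one`, the square-root-of-unity lemma);
* **`exists_ne_zero_mem_short`**: the pigeon-hole short vector of `L` (indeed of `L₀` — which is exactly why membership
  in `L ∖ L₀` is the ASSUMPTION): if `N ≤ (2M+1)^d` then `L₀` has a nonzero vector with all `|z_i| ≤ 2M`;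
* `ShortVectorHypothesis` = the hypothesis of Thm 1.1 for an instance, and the printed resource functions (`runs`,
  `circuitSizeGrowth`, `qubitGrowth`, the RV24 qubit coefficient, Pilatte's growths) with their arithmetic.
The quantum circuit and Thm 1.1 itself are not asserted (no named fact).

## References
* [Regev2023] O. Regev, arXiv:2308.06572v2, pp. 3–4 (read via `lit read arxiv:2308.06572`).
* [RagavanVaikuntanathan2023] S. Ragavan, V. Vaikuntanathan, arXiv:2310.00899, Main Thm 1 (p. 4).
* [Pilatte2024] C. Pilatte, arXiv:2404.16450, Thm 1.1 (p. 3).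
-/

namespace Literature.Computability.Cryptography

namespace Regev2023

open Finset

variable {N d : ℕ}

/-! ### The exponent lattice `L` and its sublattice `L₀` -/

/-- `Π_i b_i^{z_i} mod N` for bases `b_i` invertible modulo `N` (if some `gcd(b_i, N) > 1` the factorisation is already
in hand) and an integer exponent vector `z ∈ ℤ^d`. [cite: Regev2023, §1 p. 3 (display (1))] -/
def prodPow (b : Fin d → (ZMod N)ˣ) (z : Fin d → ℤ) : (ZMod N)ˣ :=
  ∏ i, b i ^ z i

/-- `Π b_i^0 = 1`. [cite: Regev2023, §1 p. 3] -/
theorem prodPow_zero (b : Fin d → (ZMod N)ˣ) : prodPow b 0 = 1 := by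
  simp [prodPow]

/-- `Π b_i^{z_i + w_i} = Π b_i^{z_i} · Π b_i^{w_i}`. [cite: Regev2023, §1 p. 3] -/
theorem prodPow_add (b : Fin d → (ZMod N)ˣ) (z w : Fin d → ℤ) :
    prodPow b (z + w) = prodPow b z * prodPow b w := by
  simp only [prodPow, Pi.add_apply, zpow_add, Finset.prod_mul_distrib]

/-- `Π b_i^{−z_i} = (Π b_i^{z_i})⁻¹`. [cite: Regev2023, §1 p. 3] -/
theorem prodPow_neg (b : Fin d → (ZMod N)ˣ) (z : Fin d → ℤ) : prodPow b (-z) = (prodPow b z)⁻¹ := by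
  simp only [prodPow, Pi.neg_apply, zpow_neg, Finset.prod_inv_distrib]

/-- `Π b_i^{z_i − w_i} = Π b_i^{z_i} · (Π b_i^{w_i})⁻¹`. [cite: Regev2023, §1 p. 3] -/
theorem prodPow_sub (b : Fin d → (ZMod N)ˣ) (z w : Fin d → ℤ) :
    prodPow b (z - w) = prodPow b z * (prodPow b w)⁻¹ := by
  rw [sub_eq_add_neg, prodPow_add, prodPow_neg]

/-- The lattice `L = {z ∈ ℤ^d : (Π_i b_i^{z_i})² = 1 mod N}` (= `{Π a_i^{z_i} = 1}`, `a_i = b_i²`), an additive subgroup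
of `ℤ^d`. [cite: Regev2023, §1 p. 3 (display (1))] -/
def lattice (b : Fin d → (ZMod N)ˣ) : AddSubgroup (Fin d → ℤ) where
  carrier := {z | prodPow b z ^ 2 = 1}
  add_mem' := by
    intro z w hz hw
    simp only [Set.mem_setOf_eq] at hz hw ⊢
    rw [prodPow_add, mul_pow, hz, hw, one_mul]
  zero_mem' := by simp [prodPow_zero]
  neg_mem' := by
    intro z hz
    simp only [Set.mem_setOf_eq] at hz ⊢
    rw [prodPow_neg, inv_pow, hz, inv_one]

/-- The sublattice `L₀ = {z ∈ ℤ^d : Π_i b_i^{z_i} ∈ {−1, 1} mod N}`. [cite: Regev2023, §1 p. 3 (display after (1))] -/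
def sublattice (b : Fin d → (ZMod N)ˣ) : AddSubgroup (Fin d → ℤ) where
  carrier := {z | prodPow b z = 1 ∨ prodPow b z = -1}
  add_mem' := by
    intro z w hz hw
    simp only [Set.mem_setOf_eq] at hz hw ⊢
    rw [prodPow_add]
    rcases hz with hz | hz <;> rcases hw with hw | hw <;> simp [hz, hw]
  zero_mem' := by simp [prodPow_zero]
  neg_mem' := by
    intro z hz
    simp only [Set.mem_setOf_eq] at hz ⊢
    rw [prodPow_neg]
    rcases hz with hz | hz
    · left; rw [hz, inv_one]
    · right; rw [hz, inv_neg_one]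

/-- Membership in `L`. [cite: Regev2023, §1 p. 3] -/
theorem mem_lattice_iff (b : Fin d → (ZMod N)ˣ) (z : Fin d → ℤ) : z ∈ lattice b ↔ prodPow b z ^ 2 = 1 := Iff.rfl

/-- Membership in `L₀`. [cite: Regev2023, §1 p. 3] -/
theorem mem_sublattice_iff (b : Fin d → (ZMod N)ˣ) (z : Fin d → ℤ) :
    z ∈ sublattice b ↔ prodPow b z = 1 ∨ prodPow b z = -1 := Iff.rfl

/-- `L₀ ⊆ L` («the sublattice of L»): `(±1)² = 1`. [cite: Regev2023, §1 p. 3] -/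
theorem sublattice_le_lattice (b : Fin d → (ZMod N)ˣ) : sublattice b ≤ lattice b := by
  intro z hz
  rw [mem_lattice_iff]
  rcases hz with hz | hz
  · rw [hz, one_pow]
  · rw [hz, neg_one_sq]

/-! ### The classical post-processing: a non-trivial square root of unity factors `N` -/

/-- **Square roots of unity factor.** If `x² = 1 (mod N)` with `x ≢ ±1`, then `g = gcd(x − 1, N)` (computed on the
representative of `x − 1` in `[0, N)`) satisfies `1 < g < N` — «N divides the product (b−1)(b+1) but does not divide
either of the terms, and we therefore must have that gcd(b−1, N) is a non-trivial factor of N».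
[cite: Regev2023, §1 p. 3] -/
theorem nontrivial_factor_of_sq_eq_one (hN : 1 < N) {x : ZMod N} (hx : x ^ 2 = 1) (h1 : x ≠ 1) (h2 : x ≠ -1) :
    1 < Nat.gcd (x - 1).val N ∧ Nat.gcd (x - 1).val N < N := by
  haveI : NeZero N := ⟨by omega⟩
  have hgN : Nat.gcd (x - 1).val N ∣ N := Nat.gcd_dvd_right _ _
  have hgv : Nat.gcd (x - 1).val N ∣ (x - 1).val := Nat.gcd_dvd_left _ _
  have hgpos : 0 < Nat.gcd (x - 1).val N := Nat.gcd_pos_of_pos_right _ (by omega)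
  constructor
  · by_contra hle
    have hg1 : Nat.gcd (x - 1).val N = 1 := by omega
    have hu : IsUnit (((x - 1).val : ℕ) : ZMod N) := (ZMod.isUnit_iff_coprime _ _).mpr hg1
    rw [ZMod.natCast_zmod_val] at hu
    have hprod : (x - 1) * (x + 1) = 0 := by
      have : (x - 1) * (x + 1) = x ^ 2 - 1 := by ring
      rw [this, hx, sub_self]
    have hx1 : x + 1 = 0 := hu.mul_right_eq_zero.mp hprod
    exact h2 (eq_neg_of_add_eq_zero_left hx1)
  · rcases lt_or_eq_of_le (Nat.le_of_dvd (by omega) hgN) with h | h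
    · exact h
    · exfalso
      have hNv : N ∣ (x - 1).val := by rw [h] at hgv; exact hgv
      have h0 : (x - 1).val = 0 := Nat.eq_zero_of_dvd_of_lt hNv (ZMod.val_lt _)
      rw [ZMod.val_eq_zero, sub_eq_zero] at h0
      exact h1 h0

/-- The printed output `gcd(b − 1, N)` for `b = Π_i b_i^{z_i} mod N` (on the representative in `[0, N)`).
[cite: Regev2023, §1 p. 3] -/
def regevFactor (b : Fin d → (ZMod N)ˣ) (z : Fin d → ℤ) : ℕ :=
  Nat.gcd (((prodPow b z : (ZMod N)ˣ) : ZMod N) - 1).val N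

/-- `gcd(b − 1, N)` divides `N`. [cite: Regev2023, §1 p. 3] -/
theorem regevFactor_dvd (b : Fin d → (ZMod N)ˣ) (z : Fin d → ℤ) : regevFactor b z ∣ N :=
  Nat.gcd_dvd_right _ _

/-- **Regev's post-processing claim**: for `z ∈ L ∖ L₀`, `gcd(Π b_i^{z_i} − 1, N)` is a NON-TRIVIAL factor of `N`:
`1 < g < N` and `g ∣ N`. «Therefore, it suffices to find a vector in L ∖ L₀.» [cite: Regev2023, §1 p. 3] -/
theorem regevFactor_nontrivial (hN : 1 < N) (b : Fin d → (ZMod N)ˣ) {z : Fin d → ℤ}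
    (hz : z ∈ lattice b) (hz0 : z ∉ sublattice b) :
    1 < regevFactor b z ∧ regevFactor b z < N ∧ regevFactor b z ∣ N := by
  have hsq : (((prodPow b z : (ZMod N)ˣ) : ZMod N)) ^ 2 = 1 := by
    have := congrArg (fun u : (ZMod N)ˣ => (u : ZMod N)) hz
    simpa using this
  have h1 : ((prodPow b z : (ZMod N)ˣ) : ZMod N) ≠ 1 := by
    intro h
    exact hz0 (Or.inl (Units.val_eq_one.mp h))
  have h2 : ((prodPow b z : (ZMod N)ˣ) : ZMod N) ≠ -1 := by
    intro h
    apply hz0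
    right
    ext
    rw [h, Units.val_neg, Units.val_one]
  obtain ⟨hlt, hltN⟩ := nontrivial_factor_of_sq_eq_one hN hsq h1 h2
  exact ⟨hlt, hltN, regevFactor_dvd b z⟩

/-! ### Short vectors of `L` by pigeon-hole -/

/-- **The pigeon-hole short vector** (footnote, p. 4: «consider all vectors z ∈ {−2^{n/d−1}, …, 2^{n/d−1}}^d. Since
there are more than 2^n ≥ N such vectors, there are two that lead to the same product … Their difference is therefore in
L»): if `N ≤ (2M+1)^d` then some nonzero `z` with all `|z_i| ≤ 2M` has `Π b_i^{z_i} = 1`, so lies in `L₀ ⊆ L`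
(Euclidean norm `≤ √d · 2M`; the printed `√d · 2^{n/d}` is `M = 2^{n/d−1}`). That such vectors may all lie in `L₀` is
exactly why Thm 1.1 needs its hypothesis. [cite: Regev2023, §1 p. 4 (footnote 2)] -/
theorem exists_ne_zero_mem_sublattice_short (hN : 1 < N) (b : Fin d → (ZMod N)ˣ) {M : ℕ}
    (hM : N ≤ (2 * M + 1) ^ d) :
    ∃ z : Fin d → ℤ, z ≠ 0 ∧ z ∈ sublattice b ∧ ∀ i, |z i| ≤ 2 * M := by
  haveI : NeZero N := ⟨by omega⟩
  let emb : (Fin d → Fin (2 * M + 1)) → (Fin d → ℤ) := fun v i => ((v i : ℕ) : ℤ)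
  let f : (Fin d → Fin (2 * M + 1)) → (ZMod N)ˣ := fun v => prodPow b (emb v)
  have hcard : Fintype.card (ZMod N)ˣ < Fintype.card (Fin d → Fin (2 * M + 1)) := by
    rw [ZMod.card_units_eq_totient, Fintype.card_fun, Fintype.card_fin, Fintype.card_fin]
    exact lt_of_lt_of_le (Nat.totient_lt N hN) hM
  obtain ⟨v, w, hvw, hfvw⟩ := Fintype.exists_ne_map_eq_of_card_lt f hcard
  refine ⟨emb v - emb w, ?_, ?_, ?_⟩
  · intro h0
    apply hvw
    funext i
    have hi := congrFun h0 i
    simp only [Pi.sub_apply, Pi.zero_apply, sub_eq_zero, emb, Nat.cast_inj] at hi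
    exact Fin.ext hi
  · left
    rw [prodPow_sub]
    have hf : prodPow b (emb v) = prodPow b (emb w) := hfvw
    rw [hf, mul_inv_cancel]
  · intro i
    have h1 := (v i).isLt
    have h2 := (w i).isLt
    simp only [Pi.sub_apply, emb]
    rw [abs_le]
    constructor <;> omega

/-- Hence `L` itself has such a short nonzero vector («L is guaranteed to have nonzero vectors of norm at most
√d·2^{n/d}»). [cite: Regev2023, §1 p. 4] -/
theorem exists_ne_zero_mem_lattice_short (hN : 1 < N) (b : Fin d → (ZMod N)ˣ) {M : ℕ}
    (hM : N ≤ (2 * M + 1) ^ d) :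
    ∃ z : Fin d → ℤ, z ≠ 0 ∧ z ∈ lattice b ∧ ∀ i, |z i| ≤ 2 * M := by
  obtain ⟨z, hz0, hz, hzM⟩ := exists_ne_zero_mem_sublattice_short hN b hM
  exact ⟨z, hz0, sublattice_le_lattice b hz, hzM⟩

/-! ### Thm 1.1: the hypothesis and the printed resource functions -/

/-- The HYPOTHESIS of Thm 1.1 for an instance `(N; b_1, …, b_d; T)`: «there exists a vector in L ∖ L₀ of norm at most
T» (Euclidean norm, written `Σ z_i² ≤ T²`). Printed as «a number-theoretic heuristic assumption» (p. 3); a version is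
PROVED for modified parameters by Pilatte 2024. This is a predicate on instances, not an assertion.
[cite: Regev2023, Thm 1.1 (hypothesis); §1 p. 3] -/
def ShortVectorHypothesis (b : Fin d → (ZMod N)ˣ) (T : ℝ) : Prop :=
  ∃ z : Fin d → ℤ, z ∈ lattice b ∧ z ∉ sublattice b ∧ (∑ i, ((z i : ℝ)) ^ 2) ≤ T ^ 2

/-- Under the hypothesis the instance carries a witness whose `gcd` output is a proper factor (the classical half of
Thm 1.1; the quantum half — FINDING such `z` with `√n + 4` circuit calls + LLL — is not asserted here).
[cite: Regev2023, Thm 1.1; §1 p. 3] -/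
theorem ShortVectorHypothesis.exists_factor (hN : 1 < N) {b : Fin d → (ZMod N)ˣ} {T : ℝ}
    (h : ShortVectorHypothesis b T) : ∃ z : Fin d → ℤ, (∑ i, ((z i : ℝ)) ^ 2) ≤ T ^ 2 ∧
      1 < regevFactor b z ∧ regevFactor b z < N ∧ regevFactor b z ∣ N := by
  obtain ⟨z, hz, hz0, hT⟩ := h
  exact ⟨z, hT, regevFactor_nontrivial hN b hz hz0⟩

/-- The printed number of quantum circuit calls: `√n + 4`. [cite: Regev2023, Thm 1.1] -/
noncomputable def runs (n : ℕ) : ℝ := Real.sqrt n + 4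

/-- The printed circuit-size growth per call: `n^{3/2} · log n` («a quantum circuit of size O(n^{3/2} log n)»).
[cite: Regev2023, Thm 1.1] -/
noncomputable def circuitSizeGrowth (n : ℕ) : ℝ := (n : ℝ) ^ (3 / 2 : ℝ) * Real.log n

/-- The printed qubit growth: `n^{3/2}` («the number of qubits in our quantum circuit is O(n^{3/2}), higher than the
O(n) in optimized implementations of Shor's algorithm»). [cite: Regev2023, §1 p. 3] -/
noncomputable def qubitGrowth (n : ℕ) : ℝ := (n : ℝ) ^ (3 / 2 : ℝ)

/-- Per call the circuit is smaller than Shor's `Õ(n²)`-size circuit by the factor `√n` (up to the log):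
`n^{3/2} · log n · √n = n² · log n`. [cite: Regev2023, §1 p. 3 («quantum circuit of size Õ(n²)» for Shor; «Õ(n^{3/2})»)] -/
theorem circuitSizeGrowth_mul_sqrt (n : ℕ) :
    circuitSizeGrowth n * Real.sqrt n = (n : ℝ) ^ 2 * Real.log n := by
  unfold circuitSizeGrowth
  have hn : (0 : ℝ) ≤ n := Nat.cast_nonneg n
  rw [Real.sqrt_eq_rpow, mul_right_comm, ← Real.rpow_add' hn (by norm_num)]
  norm_num

/-- Summed over the `√n + 4` calls, the gate count is NOT below `n² · log n`: the saving is per-call SIZE, not total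
work (`(√n + 4) · n^{3/2} log n ≥ n² log n` for `n ≥ 1`). [cite: Regev2023, Thm 1.1 (arithmetic of the printed functions)] -/
theorem sq_mul_log_le_runs_mul_circuitSizeGrowth {n : ℕ} (hn : 1 ≤ n) :
    (n : ℝ) ^ 2 * Real.log n ≤ runs n * circuitSizeGrowth n := by
  rw [← circuitSizeGrowth_mul_sqrt, mul_comm (runs n)]
  unfold runs circuitSizeGrowth
  have hlog : 0 ≤ Real.log n := Real.log_nonneg (by exact_mod_cast hn)
  have hpow : 0 ≤ (n : ℝ) ^ (3 / 2 : ℝ) := Real.rpow_nonneg (Nat.cast_nonneg n) _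
  have hbase : 0 ≤ (n : ℝ) ^ (3 / 2 : ℝ) * Real.log n := mul_nonneg hpow hlog
  apply mul_le_mul_of_nonneg_left _ hbase
  linarith [Real.sqrt_nonneg (n : ℝ)]

/-- Ragavan–Vaikuntanathan, Main Thm 1: the qubit count is `S + ((C+2)/log φ + 6 + o(1))·n`, `φ` the golden ratio,
`C` the constant of Regev's hypothesis, `S`/`G` the ancillas/gates of the modular multiply–add circuit; printed
`≈ S + (1.44C + 8.88)·n` (logarithm to base 2), with `O(n^{1/2}·G + n^{3/2})` gates per call and the same `√n + 4`
calls. This is the leading coefficient. [cite: RagavanVaikuntanathan2023, Main Thm 1 (p. 4)] -/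
noncomputable def rv24QubitCoeff (C : ℝ) : ℝ :=
  (C + 2) / Real.logb 2 ((1 + Real.sqrt 5) / 2) + 6

/-- Pilatte 2024, Thm 1.1 (the PROVED variant): gates `n^{3/2} · log³ n` per circuit. [cite: Pilatte2024, Thm 1.1 (p. 3)] -/
noncomputable def pilatteGateGrowth (n : ℕ) : ℝ := (n : ℝ) ^ (3 / 2 : ℝ) * Real.log n ^ 3

/-- Pilatte 2024, Thm 1.1: qubits `n · log³ n`. [cite: Pilatte2024, Thm 1.1 (p. 3)] -/
noncomputable def pilatteQubitGrowth (n : ℕ) : ℝ := (n : ℝ) * Real.log n ^ 3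

/-- Pilatte's proved variant costs exactly a `log² n` factor in gates over Regev's printed growth («up to logarithmic
factors»). [cite: Pilatte2024, Thm 1.1 and the sentence after it (p. 3)] -/
theorem pilatteGateGrowth_eq (n : ℕ) : pilatteGateGrowth n = circuitSizeGrowth n * Real.log n ^ 2 := by
  unfold pilatteGateGrowth circuitSizeGrowth
  ring

end Regev2023

end Literature.Computability.Cryptography
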